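import Summits.NavierStokesRegularity.NavierStokesRegularity.Theorems.QuarterJoltFrameTightness
import Summits.NavierStokesRegularity.NavierStokesRegularity.Theorems.QuarterJoltLocalEnergyContinuityOfUI
import Summits.NavierStokesRegularity.NavierStokesRegularity.Theorems.QuarterJoltEnergyJumpLaw
import Summits.NavierStokesRegularity.NavierStokesRegularity.Theorems.QuarterJoltTypeIIEnergyEqualityEdges
import Summits.NavierStokesRegularity.NavierStokesRegularity.Theses.HodographBetchov

set_option linter.dupNamespace false

/-!
# Route QuarterJolt — crux `NoTerminalJolt` (stmt-NavierStokesRegularity-26463), LEAD line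
# `regular_split`: STUB 3 IS SHELF STATEMENT stmt-18118 — uniformly integrable energy ⇒ ENERGY
# EQUALITY at the terminal time

Seat ns-ntj-p1 g5 (LEAD of the crux; `--supports 26463 --as helper`). Assembling
`QuarterJoltLocalEnergyContinuityOfUI` (18118-type uniform integrability ⇒ `L²_loc` convergence at `T`,
CKN-slice route) with `QuarterJoltFrameTightness` (no energy escapes to spatial infinity as `t ↑ T`):

* `NoTerminalJolt.tendsto_integral_norm_sub_sq_of_uniformIntegrable` — `(u,p)` classical on `[0,T)`
  with viscosity `ν > 0`, Leray–Hopf on `[0,T]`, energy uniformly integrable over speed classes on a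
  final interval ⇒ `∫‖u(t) − u(T)‖² → 0` as `t ↑ T`: NO ENERGY JUMP (= energy equality on `[0,T]`,
  `QuarterJoltEnergyJumpLaw` / `QuarterJoltEnergyJumpDefect`); `…tendsto_eLpNorm_sub_of_uniformIntegrable`.
* **`energyContinuity_of_noFastEnergyConcentration : NoFastEnergyConcentration (stmt-18118) →
  (every frame solution is strongly L²-continuous into its terminal time)`** and
  **`typeIIEnergyEquality_of_noFastEnergyConcentration : 18118 → ‹stub_typeIIEnergyEquality›`**
  (the registered stub 3 of line `regular_split`, statement verbatim).
* **`typeIIEnergyEquality_iff_noFastEnergyConcentration : ‹stub 3› ↔ NoFastEnergyConcentration`** —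
  with the landed converse `noFastEnergyConcentration_of_typeIIEnergyEquality` (p642789): STUB 3 OF
  THE LINE IS EXACTLY THE SHELF STATEMENT stmt-18118. Consequently (rev 7 of the skeleton)
  `NoTerminalJolt ⟺ NoTypeIBlowup (1217) ∧ NoFastEnergyConcentration (18118) ∧ TypeIIRate`.

In print: energy equality ⟺ no concentration of the energy measure at `T` (Leslie–Shvydkoy, ARMA 230
(2018) §1.3/§4, for Type-I-in-time / `L^qL^p` classes); the uniform-integrability ⟺ energy-equality
statement for frame solutions is, as far as searched, not stated in print — it is elementary given CKN's
partial regularity at the top slice and Leray's far-field estimate, both in the tree.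

HONEST FRAMING: conditional implications between OPEN statements; nothing here proves stmt-18118,
stub 3, `NoTerminalJolt` or Navier–Stokes regularity; no summit statement is proved here.
[cite: LeslieShvydkoy2017, Thm. 1.2 and §4; CaffarelliKohnNirenberg1982, Thm B; Leray1934, §32]
-/

noncomputable section

open MeasureTheory TopologicalSpace Set Function Filter Metric
open _root_.Topology
open scoped ENNReal NNReal

namespace Summit.NavierStokesRegularity.NavierStokesRegularity.Theorems

open Literature.Analysis.FluidPDE

namespace NoTerminalJolt

/-- **UNIFORMLY INTEGRABLE ENERGY ⇒ NO ENERGY JUMP.** For `(u,p)` classical on `[0,T)` with viscosity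
`ν > 0`, Leray–Hopf on `[0,T]`, whose energy is uniformly integrable over speed classes on a final
interval (`∀ ε > 0 ∃ l > 0 ∀ t ∈ (T₁,T): ∫_{|u(t)|>l} |u(t)|² ≤ ε`): `∫‖u(t) − u(T)‖² → 0` as `t ↑ T`.
Local convergence on a large ball (`tendsto_localEnergy_sub_top_of_uniformIntegrable`) + tightness of
`|u(t)|²` (`tight_energy_of_frame`) and of `|u(T)|²`. [cite: LeslieShvydkoy2017, §4; CaffarelliKohnNirenberg1982, Thm B; Leray1934, §32] -/
theorem tendsto_integral_norm_sub_sq_of_uniformIntegrable {ν T : ℝ} (hν : 0 < ν) (hT : 0 < T)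
    {u : ℝ → EuclideanSpace ℝ (Fin 3) → EuclideanSpace ℝ (Fin 3)}
    {p : ℝ → EuclideanSpace ℝ (Fin 3) → ℝ}
    (hcl : IsClassicalNSSolutionOn (Set.Ico 0 T) ν 0 u p) (hLH : IsLerayHopfOn T ν 0 (u 0) u)
    {T₁ : ℝ} (hT₁T : T₁ < T)
    (hUI : ∀ ε : ℝ, 0 < ε → ∃ l : ℝ, 0 < l ∧ ∀ t ∈ Ioo T₁ T,
      ∫⁻ x in {x | l < ‖u t x‖}, ‖u t x‖ₑ ^ 2 ≤ ENNReal.ofReal ε) :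
    Tendsto (fun t => ∫ x, ‖u t x - u T x‖ ^ 2) (𝓝[<] T) (𝓝 0) := by
  have hmT : MemLp (u T) 2 volume := hLH.memLp T ⟨hT.le, le_rfl⟩
  have hsqT : Integrable (fun x => ‖u T x‖ ^ 2) volume := hmT.integrable_norm_pow two_ne_zero
  rw [Metric.tendsto_nhds]
  intro ε hε
  -- (1) tightness of the flow on `[T/2, T)` and of the terminal slice
  obtain ⟨R₁, hR₁, htight⟩ := tight_energy_of_frame hν hT hcl hLH (show (0 : ℝ) < ε / 16 by positivity)
  have htailT : Tendsto (fun k : ℕ => ∫ x in {x : EuclideanSpace ℝ (Fin 3) | (k : ℝ) ≤ ‖x‖},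
      ‖u T x‖ ^ 2) atTop (𝓝 0) := by
    have hanti : Antitone fun k : ℕ => {x : EuclideanSpace ℝ (Fin 3) | (k : ℝ) ≤ ‖x‖} :=
      fun k m hkm x hx => show (k : ℝ) ≤ ‖x‖ from
        le_trans (Nat.cast_le.2 hkm) (show (m : ℝ) ≤ ‖x‖ from hx)
    have h := tendsto_setIntegral_of_antitone (μ := volume) (f := fun x => ‖u T x‖ ^ 2)
      (fun k => (isClosed_le continuous_const continuous_norm).measurableSet) hanti
      ⟨0, hsqT.integrableOn⟩
    have hempty : (⋂ k : ℕ, {x : EuclideanSpace ℝ (Fin 3) | (k : ℝ) ≤ ‖x‖}) = ∅ := by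
      ext x
      simp only [mem_iInter, mem_setOf_eq, mem_empty_iff_false, iff_false, not_forall, not_le]
      exact exists_nat_gt ‖x‖
    rwa [hempty, Measure.restrict_empty, integral_zero_measure] at h
  obtain ⟨k₂, hk₂⟩ := (htailT.eventually
    (Iic_mem_nhds (show (0 : ℝ) < ε / 16 by positivity))).exists_forall_of_atTop
  -- a common radius
  obtain ⟨R, hRR₁, hRk₂, hR0⟩ : ∃ R : ℝ, R₁ ≤ R ∧ (k₂ : ℝ) ≤ R ∧ 0 < R :=
    ⟨max R₁ k₂, le_max_left _ _, le_max_right _ _, lt_of_lt_of_le hR₁ (le_max_left _ _)⟩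
  set A : Set (EuclideanSpace ℝ (Fin 3)) := {x | R ≤ ‖x‖} with hA
  have hmeasA : MeasurableSet A := (isClosed_le continuous_const continuous_norm).measurableSet
  have htailt : ∀ t ∈ Ico (T / 2) T, ∫ x in A, ‖u t x‖ ^ 2 ≤ ε / 16 := by
    intro t ht
    have ht0 : (0 : ℝ) ≤ t := by linarith [ht.1]
    refine le_trans (setIntegral_mono_set
      ((hLH.memLp t ⟨ht0, ht.2.le⟩).integrable_norm_pow two_ne_zero).integrableOn
      (ae_of_all _ fun x => sq_nonneg _) (Eventually.of_forall fun x (hx : R ≤ ‖x‖) => ?_))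
      (htight t ht)
    exact le_trans hRR₁ hx
  have htailT' : ∫ x in A, ‖u T x‖ ^ 2 ≤ ε / 16 := by
    refine le_trans (setIntegral_mono_set hsqT.integrableOn (ae_of_all _ fun x => sq_nonneg _)
      (Eventually.of_forall fun x (hx : R ≤ ‖x‖) => ?_)) (hk₂ k₂ le_rfl)
    exact le_trans hRk₂ hx
  -- (2) local convergence on the ball `B(0, R+1) ⊇ Aᶜ`
  have hloc := tendsto_localEnergy_sub_top_of_uniformIntegrable hν hT hcl hLH hT₁T hUI 0 (R + 1)
  have hδ : (0 : ℝ≥0∞) < ENNReal.ofReal (ε / 4) := ENNReal.ofReal_pos.2 (by positivity)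
  have hT2 : Ioo (T / 2) T ∈ 𝓝[<] T := Ioo_mem_nhdsLT (by linarith)
  filter_upwards [hloc.eventually (gt_mem_nhds hδ), hT2] with t hlt ht
  have ht' : t ∈ Ico (T / 2) T := ⟨ht.1.le, ht.2⟩
  have ht0 : (0 : ℝ) ≤ t := by linarith [ht.1]
  have hmt : MemLp (u t) 2 volume := hLH.memLp t ⟨ht0, ht.2.le⟩
  have hsqt : Integrable (fun x => ‖u t x‖ ^ 2) volume := hmt.integrable_norm_pow two_ne_zero
  have hdiff : Integrable (fun x => ‖u t x - u T x‖ ^ 2) volume :=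
    (hmt.sub hmT).integrable_norm_pow two_ne_zero
  -- the local part, as a real number
  have hball : ∫ x in ball (0 : EuclideanSpace ℝ (Fin 3)) (R + 1), ‖u t x - u T x‖ ^ 2 < ε / 4 := by
    have heq : ∫⁻ z in ball (0 : EuclideanSpace ℝ (Fin 3)) (R + 1), ‖u t z - u T z‖ₑ ^ 2 =
        ENNReal.ofReal (∫ x in ball (0 : EuclideanSpace ℝ (Fin 3)) (R + 1), ‖u t x - u T x‖ ^ 2) := by
      rw [integral_eq_lintegral_of_nonneg_ae (Eventually.of_forall fun x => sq_nonneg _)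
        hdiff.integrableOn.aestronglyMeasurable,
        ENNReal.ofReal_toReal hdiff.integrableOn.lintegral_lt_top.ne]
      exact lintegral_congr fun x => by rw [← ofReal_norm, ENNReal.ofReal_pow (norm_nonneg _)]
    rw [heq, ENNReal.ofReal_lt_ofReal_iff (by positivity)] at hlt
    exact hlt
  -- the far part
  have hcompl : (ball (0 : EuclideanSpace ℝ (Fin 3)) (R + 1))ᶜ ⊆ A := by
    intro x hx
    rw [mem_compl_iff, mem_ball, dist_zero_right, not_lt] at hx
    show R ≤ ‖x‖
    linarith
  have hfar : ∫ x in (ball (0 : EuclideanSpace ℝ (Fin 3)) (R + 1))ᶜ, ‖u t x - u T x‖ ^ 2 ≤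
      2 * (ε / 16) + 2 * (ε / 16) := by
    calc ∫ x in (ball (0 : EuclideanSpace ℝ (Fin 3)) (R + 1))ᶜ, ‖u t x - u T x‖ ^ 2
        ≤ ∫ x in A, ‖u t x - u T x‖ ^ 2 :=
          setIntegral_mono_set hdiff.integrableOn (ae_of_all _ fun x => sq_nonneg _)
            hcompl.eventuallyLE
      _ ≤ ∫ x in A, (2 * ‖u t x‖ ^ 2 + 2 * ‖u T x‖ ^ 2) := by
          refine integral_mono hdiff.integrableOn
            ((hsqt.const_mul 2).add (hsqT.const_mul 2)).integrableOn fun x => ?_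
          have h := norm_sub_le (u t x) (u T x)
          nlinarith [norm_nonneg (u t x), norm_nonneg (u T x), norm_nonneg (u t x - u T x),
            sq_nonneg (‖u t x‖ - ‖u T x‖)]
      _ = 2 * (∫ x in A, ‖u t x‖ ^ 2) + 2 * ∫ x in A, ‖u T x‖ ^ 2 := by
          rw [integral_add (hsqt.const_mul 2).integrableOn (hsqT.const_mul 2).integrableOn,
            integral_const_mul, integral_const_mul]
      _ ≤ 2 * (ε / 16) + 2 * (ε / 16) :=
          add_le_add (mul_le_mul_of_nonneg_left (htailt t ht') (by norm_num))
            (mul_le_mul_of_nonneg_left htailT' (by norm_num))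
  -- assemble
  have hsplit := integral_add_compl (μ := volume) (s := ball (0 : EuclideanSpace ℝ (Fin 3)) (R + 1))
    measurableSet_ball hdiff
  rw [Real.dist_eq, sub_zero, abs_of_nonneg (integral_nonneg fun x => sq_nonneg _), ← hsplit]
  linarith

/-- `L²`-norm form: uniformly integrable energy ⇒ `‖u(t) − u(T)‖_{L²} → 0` as `t ↑ T`. -/
theorem tendsto_eLpNorm_sub_of_uniformIntegrable {ν T : ℝ} (hν : 0 < ν) (hT : 0 < T)
    {u : ℝ → EuclideanSpace ℝ (Fin 3) → EuclideanSpace ℝ (Fin 3)}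
    {p : ℝ → EuclideanSpace ℝ (Fin 3) → ℝ}
    (hcl : IsClassicalNSSolutionOn (Set.Ico 0 T) ν 0 u p) (hLH : IsLerayHopfOn T ν 0 (u 0) u)
    {T₁ : ℝ} (hT₁T : T₁ < T)
    (hUI : ∀ ε : ℝ, 0 < ε → ∃ l : ℝ, 0 < l ∧ ∀ t ∈ Ioo T₁ T,
      ∫⁻ x in {x | l < ‖u t x‖}, ‖u t x‖ₑ ^ 2 ≤ ENNReal.ofReal ε) :
    Tendsto (fun t => eLpNorm (u t - u T) 2 volume) (𝓝[<] T) (𝓝 0) :=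
  (tendsto_eLpNorm_sub_iff_tendsto_integral_norm_sub_sq hT hLH).2
    (tendsto_integral_norm_sub_sq_of_uniformIntegrable hν hT hcl hLH hT₁T hUI)

end NoTerminalJolt

/-! ### By name: stub 3 of `regular_split` is the shelf statement stmt-18118 -/

/-- **`NoFastEnergyConcentration ⇒ energy continuity at every frame time`** (stmt-18118 BY NAME):
every classical solution on `[0,T)` which is Leray–Hopf on `[0,T]` from a rapidly decaying datum is
strongly `L²`-continuous into `T` — no energy jump at any frame time, blow-up or not. Conditional on
the OPEN statement 18118. [folklore] -/
theorem energyContinuity_of_noFastEnergyConcentration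
    (h : Theses.HodographBetchov.NoFastEnergyConcentration) :
    ∀ (ν T : ℝ), 0 < ν → 0 < T →
      ∀ (u : ℝ → EuclideanSpace ℝ (Fin 3) → EuclideanSpace ℝ (Fin 3))
        (p : ℝ → EuclideanSpace ℝ (Fin 3) → ℝ),
        Literature.Analysis.FluidPDE.IsClassicalNSSolutionOn (Set.Ico 0 T) ν 0 u p →
        Literature.Analysis.FluidPDE.IsLerayHopfOn T ν 0 (u 0) u →
        Literature.Analysis.FluidPDE.HasRapidSpatialDecay (u 0) →
        Filter.Tendsto (fun t => MeasureTheory.eLpNorm (u t - u T) 2 MeasureTheory.volume)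
          (nhdsWithin T (Set.Iio T)) (nhds 0) := by
  intro ν T hν hT u p hcl hLH hdec
  have hUI : ∀ ε : ℝ, 0 < ε → ∃ l : ℝ, 0 < l ∧ ∀ t ∈ Ioo 0 T,
      ∫⁻ x in {x | l < ‖u t x‖}, ‖u t x‖ₑ ^ 2 ≤ ENNReal.ofReal ε := by
    intro ε hε
    obtain ⟨l, hl0, hl⟩ := h ν T hν hT u p hcl hLH hdec ε hε
    exact ⟨l, hl0, fun t ht => hl t ⟨ht.1.le, ht.2⟩⟩
  exact NoTerminalJolt.tendsto_eLpNorm_sub_of_uniformIntegrable hν hT hcl hLH hT hUI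

/-- **`NoFastEnergyConcentration ⇒ stub 3`** (stmt-18118 BY NAME ⇒ the registered statement of
`stub_typeIIEnergyEquality` of line `regular_split` on crux stmt-26463, VERBATIM): a non-Type-I first
blow-up in the frame has no energy jump. Conditional on the OPEN statement 18118. [folklore] -/
theorem typeIIEnergyEquality_of_noFastEnergyConcentration
    (h : Theses.HodographBetchov.NoFastEnergyConcentration) :
    ∀ (ν T : ℝ), 0 < ν → 0 < T →
      ∀ (u : ℝ → EuclideanSpace ℝ (Fin 3) → EuclideanSpace ℝ (Fin 3))
        (p : ℝ → EuclideanSpace ℝ (Fin 3) → ℝ),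
        Literature.Analysis.FluidPDE.IsMaximalSmoothSolution ν 0 u p T →
        Literature.Analysis.FluidPDE.IsLerayHopfOn T ν 0 (u 0) u →
        Literature.Analysis.FluidPDE.HasRapidSpatialDecay (u 0) →
        ¬ Literature.Analysis.FluidPDE.IsTypeIBlowup u T →
        Filter.Tendsto (fun t => MeasureTheory.eLpNorm (u t - u T) 2 MeasureTheory.volume)
          (nhdsWithin T (Set.Iio T)) (nhds 0) :=
  fun ν T hν hT u p hmax hLH hdec _ =>
    energyContinuity_of_noFastEnergyConcentration h ν T hν hT u p hmax.1 hLH hdec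

/-- **STUB 3 ⟺ stmt-18118.** The registered statement of `stub_typeIIEnergyEquality` (line
`regular_split`, crux stmt-26463) is EQUIVALENT to the shelf statement `NoFastEnergyConcentration`
(stmt-18118, route HodographBetchov): `⇒` is `noFastEnergyConcentration_of_typeIIEnergyEquality`
(p642789), `⇐` is `typeIIEnergyEquality_of_noFastEnergyConcentration`. So the crux splits EXACTLY as
`NoTerminalJolt ⟺ NoTypeIBlowup (1217) ∧ NoFastEnergyConcentration (18118) ∧ TypeIIRate`. Nothing is
asserted about either side. [folklore] -/
theorem typeIIEnergyEquality_iff_noFastEnergyConcentration :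
    (∀ (ν T : ℝ), 0 < ν → 0 < T →
      ∀ (u : ℝ → EuclideanSpace ℝ (Fin 3) → EuclideanSpace ℝ (Fin 3))
        (p : ℝ → EuclideanSpace ℝ (Fin 3) → ℝ),
        Literature.Analysis.FluidPDE.IsMaximalSmoothSolution ν 0 u p T →
        Literature.Analysis.FluidPDE.IsLerayHopfOn T ν 0 (u 0) u →
        Literature.Analysis.FluidPDE.HasRapidSpatialDecay (u 0) →
        ¬ Literature.Analysis.FluidPDE.IsTypeIBlowup u T →
        Filter.Tendsto (fun t => MeasureTheory.eLpNorm (u t - u T) 2 MeasureTheory.volume)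
          (nhdsWithin T (Set.Iio T)) (nhds 0)) ↔
    Theses.HodographBetchov.NoFastEnergyConcentration :=
  ⟨NoTerminalJolt.noFastEnergyConcentration_of_typeIIEnergyEquality,
    typeIIEnergyEquality_of_noFastEnergyConcentration⟩

end Summit.NavierStokesRegularity.NavierStokesRegularity.Theorems

end
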